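import Mathlib
import HarnessLib
import Literature.MathematicalPhysics.QuantumLattice.HubbardBandSectorCountingToolbox
import Summits.HubbardSuperconductivity.HubbardSuperconductivity.Theorems.KLProgrammeKLRegimeTwoPointLimitShellSecondOrder

/-!
# Route `KLProgramme` (cruxes K3/K1, risk r2) — FST II Theorem 1.1 (two-loop volume) for the Hubbard band, part 2:
# real-variable window lemmas and the outer estimate near the Cooper point

Cell `gate-hubbard-kl`, seat fs-1 (g5), risk-register item r2; companion of `KLProgrammeFermiSurfaceTwoLoopLevel.lean`
(the programme is described there). Contents:

* `kltl_volume_nearPoint_le` — **Cooper side of the outer variable**: for a level `μ ∈ [a, b] ⊂ (-4, 0)`, a sign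
  `τ = ±1`, a shift `q` and `0 < s < π - K_b`, the parameters `θ` of one period with `τ p_μ(θ) + q` within sup-distance
  `s` of `2πℤ²` form a set of measure `≤ 4π√2 s/u_min` (two such parameters use the SAME lattice translate because
  `|X|, |Y| ≤ K_b`; then the chord bound `4u_min² sin²(Δ/2) ≤ |p(θ) - p(θ')|²`, `chord_lower`, and
  `near_zero_or_pi_of_abs_sin_le`);
* three real-variable lemmas for a function with two derivatives everywhere: `kltl_deriv_constSign` (a derivative
  bounded away from `0` in absolute value on an interval has constant sign — Darboux), `kltl_volume_sublevel_le_of_deriv_ge`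
  / `_le` (monotone window: `g' ≥ Λ` ⇒ `vol{|g| ≤ δ} ≤ 2δ/Λ`), `kltl_volume_sublevel_le_of_concave_sqrt` (p1b's
  `klsc_volume_sublevel_le_of_convex_sqrt` for `-g`), and **the window lemma** `kltl_volume_window_le`: if
  `|g| + |g'| + |g''| ≥ m` on `[x, y]` and `g`, `g'` oscillate by `< m/6` there, then `vol{z ∈ [x, y] : |g z| ≤ δ} ≤
  6√(3δ/m) + 12δ/m` for `0 < δ ≤ m/6`.

No definitions; everything PROVED. [folklore]
-/

noncomputable section

open Real Set MeasureTheory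
open scoped ENNReal

-- the tree's namespace `Summit.<Summit>.<Problem>.Theorems` repeats the summit name by design (D-0017)
set_option linter.dupNamespace false

namespace Summit.HubbardSuperconductivity.HubbardSuperconductivity.Theorems

open Literature.MathematicalPhysics.QuantumLattice
open Literature.MathematicalPhysics.QuantumLattice.BandSectorCounting

/-! ### §1 Near the Cooper point: the angular measure of the Fermi curve inside a sup-ball is `O(s)` -/

section Cooper

variable {a b : ℝ} (B : BandBounds a b) {μ : ℝ} (hμ : μ ∈ Icc a b)
include B hμ

/-- Two parameters in one period whose curve points are `2s`-close (sup norm, coordinatewise) are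
`π√2 s/u_min`-close modulo `2π`: `|θ - θ'| ≤ r` or `2π - r ≤ |θ - θ'|`, `r = π √2 s / u_min`
(chord bound `4u_min² sin²(Δ/2) ≤ |p(θ) - p(θ')|²`). [folklore] -/
theorem kltl_angle_close_of_point_close {θ θ' s : ℝ} (hs : 0 ≤ s) (hθθ' : |θ - θ'| ≤ 2 * π)
    (hx : |bandX μ θ - bandX μ θ'| < 2 * s) (hy : |bandY μ θ - bandY μ θ'| < 2 * s) :
    |θ - θ'| ≤ π * Real.sqrt 2 * s / B.umin ∨ 2 * π - π * Real.sqrt 2 * s / B.umin ≤ |θ - θ'| := by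
  have hu := B.umin_pos
  have hch := chord_lower B hμ θ θ'
  have h2 : 0 < Real.sqrt 2 := Real.sqrt_pos.2 (by norm_num)
  have hs2 : Real.sqrt 2 ^ 2 = 2 := Real.sq_sqrt (by norm_num)
  -- `sin²(Δ/2) ≤ 2 s² / u_min²`
  have hsq : Real.sin ((θ - θ') / 2) ^ 2 ≤ (Real.sqrt 2 * s / B.umin) ^ 2 := by
    have hx2 : (bandX μ θ - bandX μ θ') ^ 2 < (2 * s) ^ 2 := by
      have := abs_nonneg (bandX μ θ - bandX μ θ')
      calc (bandX μ θ - bandX μ θ') ^ 2 = |bandX μ θ - bandX μ θ'| ^ 2 := (sq_abs _).symm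
        _ < (2 * s) ^ 2 := by gcongr
    have hy2 : (bandY μ θ - bandY μ θ') ^ 2 < (2 * s) ^ 2 := by
      have := abs_nonneg (bandY μ θ - bandY μ θ')
      calc (bandY μ θ - bandY μ θ') ^ 2 = |bandY μ θ - bandY μ θ'| ^ 2 := (sq_abs _).symm
        _ < (2 * s) ^ 2 := by gcongr
    rw [div_pow, mul_pow, hs2, le_div_iff₀ (by positivity)]
    nlinarith
  have habs : |Real.sin ((θ - θ') / 2)| ≤ Real.sqrt 2 * s / B.umin := by
    rw [← Real.sqrt_sq_eq_abs, ← Real.sqrt_sq (show 0 ≤ Real.sqrt 2 * s / B.umin by positivity)]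
    exact Real.sqrt_le_sqrt hsq
  have hhalf : |(θ - θ') / 2| ≤ π := by rw [abs_div, abs_two]; linarith
  rcases near_zero_or_pi_of_abs_sin_le hhalf habs with h | h
  · left
    rw [abs_div, abs_two] at h
    have : |θ - θ'| ≤ π * (Real.sqrt 2 * s / B.umin) := by linarith
    calc |θ - θ'| ≤ π * (Real.sqrt 2 * s / B.umin) := this
      _ = π * Real.sqrt 2 * s / B.umin := by ring
  · right
    rw [abs_div, abs_two] at h
    have : 2 * π - π * (Real.sqrt 2 * s / B.umin) ≤ |θ - θ'| := by linarith
    calc 2 * π - π * Real.sqrt 2 * s / B.umin = 2 * π - π * (Real.sqrt 2 * s / B.umin) := by ring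
      _ ≤ |θ - θ'| := this

/-- **Near the Cooper point.** For a sign `τ = ±1`, a shift `q` and a radius `0 < s < π - K_b`, the set of
parameters `θ` in one period for which `τ p_μ(θ) + q` lies within sup-distance `s` of the lattice `2πℤ²` has
measure `≤ 4π√2 s / u_min`: two such parameters use the SAME lattice translate (`|X|, |Y| ≤ K_b` and
`2s < 2π - 2K_b`), so their curve points are `2s`-close and `kltl_angle_close_of_point_close` applies. [folklore] -/
theorem kltl_volume_nearPoint_le {τ : ℝ} (hτ : τ = 1 ∨ τ = -1) (q₁ q₂ θ₀ : ℝ) {s : ℝ} (hs : 0 < s)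
    (hsK : s < π - umklappRadius b) :
    volume {θ ∈ Icc θ₀ (θ₀ + 2 * π) | ∃ m₀ m₁ : ℤ,
        max |τ * bandX μ θ + q₁ - m₀ * (2 * π)| |τ * bandY μ θ + q₂ - m₁ * (2 * π)| < s} ≤
      ENNReal.ofReal (4 * π * Real.sqrt 2 * s / B.umin) := by
  obtain ⟨hμ₁, hμ₂⟩ := B.level hμ
  have hu := B.umin_pos
  have hπ := Real.pi_pos
  have hτabs : |τ| = 1 := by rcases hτ with rfl | rfl <;> simp
  set T := {θ ∈ Icc θ₀ (θ₀ + 2 * π) | ∃ m₀ m₁ : ℤ,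
        max |τ * bandX μ θ + q₁ - m₀ * (2 * π)| |τ * bandY μ θ + q₂ - m₁ * (2 * π)| < s} with hT
  set r := π * Real.sqrt 2 * s / B.umin with hr
  have hr0 : 0 ≤ r := by positivity
  rcases T.eq_empty_or_nonempty with hemp | ⟨θs, hθs⟩
  · rw [hemp, measure_empty]; exact bot_le
  obtain ⟨hθsI, m₀s, m₁s, hms⟩ := hθs
  -- every point of `T` uses the same translate as `θs`, hence is `r`-close to `θs` modulo `2π`
  have hK : ∀ θ, |bandX μ θ| ≤ umklappRadius b ∧ |bandY μ θ| ≤ umklappRadius b := fun θ =>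
    ⟨(abs_bandX_le_umklappRadius hμ₁ hμ₂ θ).trans (umklappRadius_mono hμ.2),
     (abs_bandY_le_umklappRadius hμ₁ hμ₂ θ).trans (umklappRadius_mono hμ.2)⟩
  have same : ∀ {X Xs : ℝ} {m ms : ℤ} {c : ℝ}, |X| ≤ umklappRadius b → |Xs| ≤ umklappRadius b →
      |τ * X + c - m * (2 * π)| < s → |τ * Xs + c - ms * (2 * π)| < s → |X - Xs| < 2 * s := by
    intro X Xs m ms c hX hXs h1 h2
    have hd : |τ * (X - Xs) - ((m - ms : ℤ) : ℝ) * (2 * π)| < 2 * s := by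
      have e : τ * (X - Xs) - ((m - ms : ℤ) : ℝ) * (2 * π) =
          (τ * X + c - m * (2 * π)) - (τ * Xs + c - ms * (2 * π)) := by push_cast; ring
      rw [e]; exact (abs_sub _ _).trans_lt (by linarith)
    have hτX : |τ * (X - Xs)| = |X - Xs| := by rw [abs_mul, hτabs, one_mul]
    have hXX : |X - Xs| ≤ 2 * umklappRadius b := (abs_sub _ _).trans (by linarith)
    by_cases hm : m = ms
    · subst hm
      simpa [hτX] using hd
    · exfalso
      have hk : (1 : ℝ) ≤ |((m - ms : ℤ) : ℝ)| := by
        rw [← Int.cast_abs]; exact_mod_cast Int.one_le_abs (sub_ne_zero.2 hm)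
      have h2π : 2 * π ≤ |((m - ms : ℤ) : ℝ) * (2 * π)| := by
        rw [abs_mul, abs_of_pos (by positivity : (0:ℝ) < 2 * π)]; nlinarith
      have := abs_sub_abs_le_abs_sub (((m - ms : ℤ) : ℝ) * (2 * π)) (τ * (X - Xs))
      rw [abs_sub_comm] at hd
      linarith
  have hclose : ∀ θ ∈ T, |θ - θs| ≤ r ∨ 2 * π - r ≤ |θ - θs| := by
    rintro θ ⟨hθI, m₀, m₁, hm⟩
    have hx : |bandX μ θ - bandX μ θs| < 2 * s :=
      same (hK θ).1 (hK θs).1 (lt_of_le_of_lt (le_max_left _ _) hm) (lt_of_le_of_lt (le_max_left _ _) hms)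
    have hy : |bandY μ θ - bandY μ θs| < 2 * s :=
      same (hK θ).2 (hK θs).2 (lt_of_le_of_lt (le_max_right _ _) hm) (lt_of_le_of_lt (le_max_right _ _) hms)
    have hθθ : |θ - θs| ≤ 2 * π := by
      rw [abs_le]; constructor <;> linarith [hθI.1, hθI.2, hθsI.1, hθsI.2]
    exact kltl_angle_close_of_point_close B hμ hs.le hθθ hx hy
  -- hence `T` is covered by three intervals of total length `4r`
  have hsub : T ⊆ Icc (θs - r) (θs + r) ∪ (Icc (θs + 2 * π - r) (θs + 2 * π) ∪ Icc (θs - 2 * π) (θs - 2 * π + r)) := by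
    intro θ hθ
    have hθI := hθ.1
    rcases hclose θ hθ with h | h
    · left; rw [abs_le] at h; exact ⟨by linarith, by linarith⟩
    · right
      rcases le_or_gt 0 (θ - θs) with h0 | h0
      · left; rw [abs_of_nonneg h0] at h
        exact ⟨by linarith, by linarith [hθI.2, hθsI.1]⟩
      · right; rw [abs_of_neg h0] at h
        exact ⟨by linarith [hθI.1, hθsI.2], by linarith⟩
  calc volume T ≤ volume (Icc (θs - r) (θs + r) ∪ (Icc (θs + 2 * π - r) (θs + 2 * π) ∪ Icc (θs - 2 * π) (θs - 2 * π + r))) :=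
        measure_mono hsub
    _ ≤ volume (Icc (θs - r) (θs + r)) + (volume (Icc (θs + 2 * π - r) (θs + 2 * π)) + volume (Icc (θs - 2 * π) (θs - 2 * π + r))) :=
        (measure_union_le _ _).trans (add_le_add le_rfl (measure_union_le _ _))
    _ = ENNReal.ofReal (4 * π * Real.sqrt 2 * s / B.umin) := by
        rw [Real.volume_Icc, Real.volume_Icc, Real.volume_Icc, ← ENNReal.ofReal_add (by linarith) (by linarith),
          ← ENNReal.ofReal_add (by linarith) (by linarith)]
        congr 1; rw [hr]; ring

end Cooper

/-! ### §6 Three real-variable window lemmas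

For a function `g` with two derivatives everywhere: (i) a derivative bounded away from zero in absolute value on an
interval has constant sign there (Darboux); (ii) if `g' ≥ Λ > 0` on `[x, y]` then `{|g| ≤ δ}` has measure `≤ 2δ/Λ`;
(iii) the window lemma: if `|g| + |g'| + |g''| ≥ m` on `[x, y]` and `g`, `g'` oscillate by `< m/6` on `[x, y]`, then
`vol{z ∈ [x, y] : |g z| ≤ δ} ≤ 6√(3δ/m) + 12δ/m` for `0 < δ ≤ m/6` — either `|g'| ≥ m/6` throughout (monotone window) or
`|g''| ≥ m/3` throughout wherever the sublevel set is non-empty (convex window, `klsc_volume_sublevel_le_of_convex_sqrt`). -/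

/-- **Constant sign (Darboux).** If `f` has derivative `f'` everywhere and `κ ≤ |f'|` on `[x, y]`, `κ > 0`, then
`f' ≥ κ` on `[x, y]` or `f' ≤ -κ` on `[x, y]`. [folklore] -/
theorem kltl_deriv_constSign {f f' : ℝ → ℝ} (hf : ∀ t, HasDerivAt f (f' t) t) {x y κ : ℝ} (hκ : 0 < κ)
    (h : ∀ t ∈ Icc x y, κ ≤ |f' t|) :
    (∀ t ∈ Icc x y, κ ≤ f' t) ∨ (∀ t ∈ Icc x y, f' t ≤ -κ) := by
  by_contra hcon
  push Not at hcon
  obtain ⟨⟨t₁, ht₁, h₁⟩, ⟨t₂, ht₂, h₂⟩⟩ := hcon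
  have h₁' : f' t₁ ≤ -κ := by
    have := h t₁ ht₁; rw [le_abs] at this
    rcases this with h' | h'
    · linarith
    · linarith
  have h₂' : κ ≤ f' t₂ := by
    have := h t₂ ht₂; rw [le_abs] at this
    rcases this with h' | h'
    · exact h'
    · linarith
  have hneg : f' t₁ < 0 := by linarith
  have hpos : 0 < f' t₂ := by linarith
  have hder : ∀ a b : ℝ, ∀ t ∈ Icc a b, HasDerivWithinAt f (f' t) (Icc a b) t :=
    fun a b t _ => (hf t).hasDerivWithinAt
  rcases le_or_gt t₁ t₂ with hle | hle
  · obtain ⟨c, hc, hc0⟩ := exists_hasDerivWithinAt_eq_of_gt_of_lt hle (hder t₁ t₂) hneg hpos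
    have hcI : c ∈ Icc x y := ⟨ht₁.1.trans hc.1.le, hc.2.le.trans ht₂.2⟩
    have := h c hcI
    rw [hc0, abs_zero] at this
    linarith
  · obtain ⟨c, hc, hc0⟩ := exists_hasDerivWithinAt_eq_of_lt_of_gt hle.le (hder t₂ t₁) hpos hneg
    have hcI : c ∈ Icc x y := ⟨ht₂.1.trans hc.1.le, hc.2.le.trans ht₁.2⟩
    have := h c hcI
    rw [hc0, abs_zero] at this
    linarith

/-- **Monotone window.** If `g' ≥ Λ > 0` on `[x, y]` then `vol{z ∈ [x, y] : |g z| ≤ δ} ≤ 2δ/Λ` (`g` crosses the band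
`[-δ, δ]` at speed `≥ Λ`). [folklore] -/
theorem kltl_volume_sublevel_le_of_deriv_ge {g g' : ℝ → ℝ} (hg : ∀ t, HasDerivAt g (g' t) t) {x y Λ δ : ℝ}
    (hΛ : 0 < Λ) (hmono : ∀ t ∈ Icc x y, Λ ≤ g' t) :
    volume {z ∈ Icc x y | |g z| ≤ δ} ≤ ENNReal.ofReal (2 * δ / Λ) := by
  have hMVT := (convex_Icc x y).mul_sub_le_image_sub_of_le_deriv
    (fun t _ => (hg t).continuousAt.continuousWithinAt)
    (fun t _ => (hg t).differentiableAt.differentiableWithinAt)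
    (fun t ht => by rw [(hg t).deriv]; exact hmono t (interior_subset ht))
  refine klsc_volume_le_of_forall_sub_le fun z hz z' hz' hzz' => ?_
  have h1 := hMVT z hz.1 z' hz'.1 hzz'
  have h2 : g z' - g z ≤ 2 * δ := by
    have := (abs_le.1 hz.2).1; have := (abs_le.1 hz'.2).2; linarith
  rw [le_div_iff₀ hΛ]
  linarith

/-- Monotone window, decreasing case: `g' ≤ -Λ < 0` on `[x, y]`. [folklore] -/
theorem kltl_volume_sublevel_le_of_deriv_le {g g' : ℝ → ℝ} (hg : ∀ t, HasDerivAt g (g' t) t) {x y Λ δ : ℝ}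
    (hΛ : 0 < Λ) (hmono : ∀ t ∈ Icc x y, g' t ≤ -Λ) :
    volume {z ∈ Icc x y | |g z| ≤ δ} ≤ ENNReal.ofReal (2 * δ / Λ) := by
  have h := kltl_volume_sublevel_le_of_deriv_ge (g := fun t => -g t) (g' := fun t => -g' t)
    (fun t => (hg t).neg) (x := x) (y := y) (δ := δ) hΛ (fun t ht => by linarith [hmono t ht])
  have hset : {z ∈ Icc x y | |(fun t => -g t) z| ≤ δ} = {z ∈ Icc x y | |g z| ≤ δ} := by
    ext z; simp only [mem_setOf_eq, abs_neg]
  rwa [hset] at h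

/-- Concave window: `g'' ≤ -c < 0` on `[x, y]` gives `vol{|g| ≤ δ} ≤ 6√(δ/c)` (p1b's convex lemma for `-g`). [folklore] -/
theorem kltl_volume_sublevel_le_of_concave_sqrt {g g' g'' : ℝ → ℝ} (hg : ∀ t, HasDerivAt g (g' t) t)
    (hg' : ∀ t, HasDerivAt g' (g'' t) t) {x y c δ : ℝ} (hc : 0 < c) (hδ : 0 < δ)
    (hconc : ∀ t ∈ Icc x y, g'' t ≤ -c) :
    volume {z ∈ Icc x y | |g z| ≤ δ} ≤ ENNReal.ofReal (6 * Real.sqrt (δ / c)) := by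
  have h := klsc_volume_sublevel_le_of_convex_sqrt (g := fun t => -g t) (g' := fun t => -g' t)
    (g'' := fun t => -g'' t) (fun t => (hg t).neg) (fun t => (hg' t).neg) (x := x) (y := y) hc hδ
    (fun t ht => by linarith [hconc t ht])
  have hset : {z ∈ Icc x y | |(fun t => -g t) z| ≤ δ} = {z ∈ Icc x y | |g z| ≤ δ} := by
    ext z; simp only [mem_setOf_eq, abs_neg]
  rwa [hset] at h

/-- **The window lemma.** See the section docstring. [folklore] -/
theorem kltl_volume_window_le {g g' g'' : ℝ → ℝ} (hg : ∀ t, HasDerivAt g (g' t) t)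
    (hg' : ∀ t, HasDerivAt g' (g'' t) t) {x y m δ : ℝ} (hm : 0 < m) (hδ : 0 < δ) (hδm : δ ≤ m / 6)
    (hF : ∀ t ∈ Icc x y, m ≤ |g t| + |g' t| + |g'' t|)
    (hωg : ∀ t ∈ Icc x y, ∀ t' ∈ Icc x y, |g t' - g t| < m / 6)
    (hωg' : ∀ t ∈ Icc x y, ∀ t' ∈ Icc x y, |g' t' - g' t| < m / 6) :
    volume {z ∈ Icc x y | |g z| ≤ δ} ≤ ENNReal.ofReal (6 * Real.sqrt (3 * δ / m) + 12 * δ / m) := by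
  have hs0 : 0 ≤ 6 * Real.sqrt (3 * δ / m) := by positivity
  have hl0 : 0 ≤ 12 * δ / m := by positivity
  by_cases hA : ∃ t ∈ Icc x y, |g' t| < m / 6
  · obtain ⟨t₀, ht₀, hsmall⟩ := hA
    have hg'b : ∀ t ∈ Icc x y, |g' t| < m / 3 := by
      intro t ht
      have h1 := hωg' t₀ ht₀ t ht
      have h2 := abs_sub_abs_le_abs_sub (g' t) (g' t₀)
      linarith
    by_cases hB : ∃ t ∈ Icc x y, |g t| ≤ δ
    · obtain ⟨t₁, ht₁, hg1⟩ := hB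
      have hgb : ∀ t ∈ Icc x y, |g t| < m / 3 := by
        intro t ht
        have h1 := hωg t₁ ht₁ t ht
        have h2 := abs_sub_abs_le_abs_sub (g t) (g t₁)
        linarith
      have hg''b : ∀ t ∈ Icc x y, m / 3 ≤ |g'' t| := by
        intro t ht
        have := hF t ht; have := hgb t ht; have := hg'b t ht
        linarith
      have hb : ENNReal.ofReal (6 * Real.sqrt (3 * δ / m)) ≤ ENNReal.ofReal (6 * Real.sqrt (3 * δ / m) + 12 * δ / m) :=
        ENNReal.ofReal_le_ofReal (by linarith)
      have hsq : Real.sqrt (δ / (m / 3)) = Real.sqrt (3 * δ / m) := by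
        congr 1; field_simp
      rcases kltl_deriv_constSign hg' (by positivity : 0 < m / 3) hg''b with hpos | hneg
      · exact ((klsc_volume_sublevel_le_of_convex_sqrt hg hg' (by positivity) hδ hpos).trans (by rw [hsq])).trans hb
      · exact ((kltl_volume_sublevel_le_of_concave_sqrt hg hg' (by positivity) hδ hneg).trans (by rw [hsq])).trans hb
    · push Not at hB
      have hempty : {z ∈ Icc x y | |g z| ≤ δ} = ∅ := by
        ext z; simp only [mem_setOf_eq, mem_empty_iff_false, iff_false, not_and, not_le]
        exact fun hz => hB z hz
      rw [hempty, measure_empty]; exact bot_le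
  · push Not at hA
    have hb : ENNReal.ofReal (2 * δ / (m / 6)) ≤ ENNReal.ofReal (6 * Real.sqrt (3 * δ / m) + 12 * δ / m) := by
      apply ENNReal.ofReal_le_ofReal
      have : 2 * δ / (m / 6) = 12 * δ / m := by field_simp; ring
      rw [this]; linarith
    rcases kltl_deriv_constSign hg (by positivity : 0 < m / 6) hA with hpos | hneg
    · exact (kltl_volume_sublevel_le_of_deriv_ge hg (by positivity) hpos).trans hb
    · exact (kltl_volume_sublevel_le_of_deriv_le hg (by positivity) hneg).trans hb

end Summit.HubbardSuperconductivity.HubbardSuperconductivity.Theorems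

end
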